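import Summits.BirchSwinnertonDyer.BirchSwinnertonDyer.Theorems.AdditiveBranchIMCGordTwoRankZeroOffCaseOneWanAnyRoadR0
import Summits.BirchSwinnertonDyer.BirchSwinnertonDyer.Theorems.AdditiveBranchIMCGordTwoRankZeroOffCaseOneFieldSupplyTwoR0
import HarnessLib

/-!
# Crux `AdditiveBranchIMC.GordTwoRankZeroOffCaseOne` (stmt-BirchSwinnertonDyer-19357), the LEAD's v36 candidate of line `three_field_road`: the two dyadic
# Wan stubs BY NAME AND SIGNATURE — `stub_fieldTwoDyadicWan : FieldTwoTwo` and `stub_dyadicWanChainR0 : FieldOneTwoR0 → FieldTwoTwo → PrintedFactsR0 → …`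

Theorems only (no definition, no named fact, no `sorry`). The two stubs of the v36 CANDIDATE v2 skeleton
`Cruxes/GordTwoRankZeroOffCaseOne/ThreeFieldRoadV36Candidate.lean` (commit bfa48bf0f321, sha256 8907cbed97b0510a; l.342 and l.350 — NOT yet registered: the
19357 LEAD registers v36/v37) proved with their signatures VERBATIM over the Theorems-side copies `WanAnyRoad.FieldOneTwoR0` / `FieldTwoTwo` / `PrintedFactsR0` /
`DyadicWanRowR0` of the line vocabulary (`AdditiveBranchIMCGordTwoRankZeroOffCaseOneWanAnyRoadR0`, p792426; bodies byte-identical to the candidate's l.278 / l.297 /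
l.250 / l.325):

* `stub_fieldTwoDyadicWan : FieldTwoTwo` — the genus-class FIELD TWO over a road field in which `2` ramifies: `WanAnyRoad.fieldTwoTwo_supply`
  (`AdditiveBranchIMCGordTwoRankZeroOffCaseOneFieldSupplyTwoR0{Aux,Class,}` = pen g44's `WanAnyFieldTwoR0Landing.lean` 7fa9383eae77 §1–§5: `d_{K''} = p*·e₂·ℓ₀*·d`
  EVEN fundamental, `2` ramified in `K''`, `u ≡ 1 (mod 8)` so `A ≅ E` over `ℚ₂`; Friedberg–Hoffstein 1995 Thm B via Hoffstein–Luo as a named hypothesis INSIDE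
  the statement);
* `stub_dyadicWanChainR0` — the dyadic Wan sub-row in analytic rank `0` from the two supplies and the twelve printed theorems:
  `WanAnyRoad.dyadicWanRowR0_closed_of_supplies` (pen g44's `WanAnyRoadR0Landing.lean` 9d44031689e8 §10–§11 over stub-1's landed port `…WanAnyRoad.{Field,Flat,
  Socket,StepL}` and `…TwistRowClosedKolyvagin`).

In the candidate skeleton (whose `ThreeFieldRoadV36Candidate.FieldOneTwoR0` / `FieldTwoTwo` / `PrintedFactsR0` / `DyadicWanRowR0` are the same terms) the two
sorries close by these names (δ-unfolding), exactly as stub-1's `…WanAnyRoadStubs` (p777589) did for 19358. HONEST LABELS: helpers only (`--supports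
stmt-BirchSwinnertonDyer-19357 --as helper`); 19357 / 19358 / 19359 stay OPEN (`stub_residualR0` research, `stub_printedFactsR0` cite-only untouched); the
row closes MODULO the twelve printed theorems of `PrintedFactsR0`; BSD is proved for no curve by any of this. Seat prover-bsd-addord-stub-2-g0 (director-bsd
(651)(m) / (684); pen g44 E362 landing order (3)).
References: [FriedbergHoffstein1995] Thm. B; [HoffsteinLuo1997] Theorem (§1); [BumpFriedbergHoffstein1990] Theorem (i); [CastellaLiuWan2022] Thm. 8.2.1 (1), §6.1;
[Hsieh2014] Thm. B; [LiuZhangZhang2018] Thm 1.5.1/1.5.3; [SkinnerUrban2014] Thm. 2 (a); [Kolyvagin1990] Thm. A.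
-/

set_option autoImplicit false
set_option linter.dupNamespace false

open scoped Classical
open NumberField IsDedekindDomain IsDedekindDomain.HeightOneSpectrum Rat.HeightOneSpectrum
open WeierstrassCurve Literature.NumberTheory.EllipticCurves
  Literature.NumberTheory.EllipticCurves.ModularForms
  Literature.NumberTheory.EllipticCurves.Rank1Residual
  Literature.NumberTheory.EllipticCurves.Rank1Residual.Typed
open Literature.NumberTheory.QuadraticFields
open Summit.BirchSwinnertonDyer.Rank1Residual
open Summit.BirchSwinnertonDyer.Rank1Residual.Additive
open Summit.BirchSwinnertonDyer.BirchSwinnertonDyer.Theorems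
open Field
open ThreeFieldRoadSupply

namespace Summit.BirchSwinnertonDyer.BirchSwinnertonDyer.Theorems.WanAnyRoad

/-- **stub (fieldTwoDyadicWan) — v36 (F2₂)**: the genus-class FIELD TWO `FieldTwoTwo` over a road field in which `2` RAMIFIES, by
`WanAnyRoad.fieldTwoTwo_supply` (statement literally the body of `FieldTwoTwo`). [cite: FriedbergHoffstein1995, Theorem B]
[cite: HoffsteinLuo1997, Theorem (§1, pp. 435–436)] [cite: SilvermanAEC2009, X.5 Cor. 5.4 and App. C §16] -/
theorem stub_fieldTwoDyadicWan : FieldTwoTwo :=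
  fieldTwoTwo_supply

/-- **stub (dyadicWanChainR0) — v36**: THE DYADIC WAN SUB-ROW IN ANALYTIC RANK ZERO FROM THE TWO SUPPLIES AND THE TWELVE PRINTED THEOREMS, by
`WanAnyRoad.dyadicWanRowR0_closed_of_supplies` (♭-inclusion ⟹ branch socket ⟹ Step L ⟹ joint lower half over `TameRoadFieldAny`; genus-road upper half;
Skinner–Urban lower half of the partner). [cite: CastellaLiuWan2022, Thm. 8.2.1 (1)] [cite: Hsieh2014, Thm. B (Doc. Math. 19 p. 713)]
[cite: LiuZhangZhang2018, Thm 1.5.1 and Thm 1.5.3] [cite: SkinnerUrban2014, Thm. 2 (a)] [cite: Kolyvagin1990, Thm. A] -/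
theorem stub_dyadicWanChainR0 : FieldOneTwoR0 → FieldTwoTwo → PrintedFactsR0 →
    ∀ (W : WeierstrassCurve ℚ) [W.IsElliptic] [W.IsGloballyMinimal] (p : ℕ) [Fact p.Prime],
      W.analyticRank = 0 → N10.CellGordTwo W p → DyadicWanRowR0 W p → MissingLowerBoundAt W p :=
  fun h1 h2 h3 => dyadicWanRowR0_closed_of_supplies h1 h2 h3

/-- **The dyadic Wan sub-row of 19357 in analytic rank `0`, CLOSED MODULO PRINT** (the v36 candidate's second case with BOTH supplies discharged by name:
`fieldOneTwoR0_holds` p777579/p792426 and `stub_fieldTwoDyadicWan`): from the cite conjunction `PrintedFactsR0` alone, for every `E/ℚ` (globally minimal `W`)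
of analytic rank `0` and every prime `p` of cell (G-ord, `e = 2`) on `DyadicWanRowR0`, `MissingLowerBoundAt W p`. [composition] -/
theorem dyadicWanRowR0_closed (hPF : PrintedFactsR0) :
    ∀ (W : WeierstrassCurve ℚ) [W.IsElliptic] [W.IsGloballyMinimal] (p : ℕ) [Fact p.Prime],
      W.analyticRank = 0 → N10.CellGordTwo W p → DyadicWanRowR0 W p → MissingLowerBoundAt W p :=
  stub_dyadicWanChainR0 fieldOneTwoR0_holds stub_fieldTwoDyadicWan hPF

end Summit.BirchSwinnertonDyer.BirchSwinnertonDyer.Theorems.WanAnyRoad
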